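import Summits.ResolutionOfSingularities.ResolutionOfSingularities.Theorems.FrobeniusLadderFInjectiveMacaulayficationOmegaOneS2KNewtonKFanChecksHge1
import HarnessLib

/-!
# HEAVY KERNEL CHECKS (fan side, (hge) ray chunks 12–23 and the glue) of the BED Ω₁ refined class model X̃₂ class-route certificate: shapes, (hgen), unimodularity, vertex bridge, pure powers, (hAJ), the vertex property (hge)
# RAY-CHUNK BY RAY-CHUNK, the local-matrix bridge `hVq` and the NEWTON MINIMISER check — each ONE `decide +kernel` on the tables of `OmegaOneS2KNewtonKFanTables` / `…FanTablesB` / `…NewtonTables`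
# (crux `FInjectiveMacaulayfication` stmt-ResolutionOfSingularities-15315, chain w45a; Omega1 F6 W1, res-L1-w45a-plan-1 R23.23 (1) F6; seat res-L1-w45a-stub-3 g12)

Support file for crux stmt-ResolutionOfSingularities-15315 (`FrobeniusLadder.FInjectiveMacaulayfication`), chain w45a.
[OURS · L1 W4.5a] — NOT a statement of any manuscript; AI-written, weaker than expert review.

The Boolean checks of res-L1-w45a-stub-4's `FanCheckKit` (+ res-L1-w45a-stub-2's `FanCheckMulti` / `FanCheckChunks`) on the BED Ω₁ refined class model X̃₂ class-route data (`f_B9 = z² + x⁹ + y⁹ + u⁹ + t⁹`, EVERY characteristic p ∤ 18 (p-uniform),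
res-L1-w45a-stub-3's `Σ_f ∧ Σ(𝔪)` fan, 1223 charts, centre `𝔪·K` with `|K| = 6032`, 6032 generators; kit job j329694-konly, certificate sha16 abe6ee2c854b2a20): `checkShapes` (no exceptional vectors, `r = 0`),
`CL.length = 1223`, `checkHgen`, `checkDetUnit`, `FanCheckMulti.checkMVBridge`, `checkHprim`, `checkHAJ`, the length check of `KL2`, the vertex property `checkHge` as 24 ray-chunk checks
`checkHgeFrom AL2 CL (6k) RAYS_k` glued by `FanCheckChunks.checkHgeFrom_append_true`, the bridge `Vq c = chartV 5 RAYS CL 1223 c`, and the NEWTON MINIMISER check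
(`U0 c ∈ SUPPv` minimises every row functional of `Vq c` over `SUPPv` — the fan refines `Σ_f`). The cover records are checked in `OmegaOneS2KNewtonKCoverChecks`; the binders are `OmegaOneS2KNewtonKFan`.
No definitions, no named facts. [folklore; cite: CoxLittleSchenck2011, §2.3]
-/

-- single-problem summit: the doubled namespace component is forced
set_option linter.dupNamespace false

namespace Summit.ResolutionOfSingularities.ResolutionOfSingularities.Theorems.FInjectiveMacaulayfication.OmegaOneS2KNewtonKFan

open Summit.ResolutionOfSingularities.ResolutionOfSingularities.Theorems.FInjectiveMacaulayfication
open FanCheckKit FanCheckSound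

/-! ## (hge) ray chunks 12–23 -/
/-- (hge), rays 72–77 (with the specimen-distinct conjunct `CL.length = 1223`). -/
theorem check_hge_12 : checkHgeFrom AL2 CL 72 RAYS_12 = true ∧ CL.length = 1223 := ⟨by decide +kernel, tlen⟩
/-- (hge), rays 78–83 (with the specimen-distinct conjunct `CL.length = 1223`). -/
theorem check_hge_13 : checkHgeFrom AL2 CL 78 RAYS_13 = true ∧ CL.length = 1223 := ⟨by decide +kernel, tlen⟩
/-- (hge), rays 84–89 (with the specimen-distinct conjunct `CL.length = 1223`). -/
theorem check_hge_14 : checkHgeFrom AL2 CL 84 RAYS_14 = true ∧ CL.length = 1223 := ⟨by decide +kernel, tlen⟩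
/-- (hge), rays 90–95 (with the specimen-distinct conjunct `CL.length = 1223`). -/
theorem check_hge_15 : checkHgeFrom AL2 CL 90 RAYS_15 = true ∧ CL.length = 1223 := ⟨by decide +kernel, tlen⟩
/-- (hge), rays 96–101 (with the specimen-distinct conjunct `CL.length = 1223`). -/
theorem check_hge_16 : checkHgeFrom AL2 CL 96 RAYS_16 = true ∧ CL.length = 1223 := ⟨by decide +kernel, tlen⟩
/-- (hge), rays 102–107 (with the specimen-distinct conjunct `CL.length = 1223`). -/
theorem check_hge_17 : checkHgeFrom AL2 CL 102 RAYS_17 = true ∧ CL.length = 1223 := ⟨by decide +kernel, tlen⟩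
/-- (hge), rays 108–113 (with the specimen-distinct conjunct `CL.length = 1223`). -/
theorem check_hge_18 : checkHgeFrom AL2 CL 108 RAYS_18 = true ∧ CL.length = 1223 := ⟨by decide +kernel, tlen⟩
/-- (hge), rays 114–119 (with the specimen-distinct conjunct `CL.length = 1223`). -/
theorem check_hge_19 : checkHgeFrom AL2 CL 114 RAYS_19 = true ∧ CL.length = 1223 := ⟨by decide +kernel, tlen⟩
/-- (hge), rays 120–125 (with the specimen-distinct conjunct `CL.length = 1223`). -/
theorem check_hge_20 : checkHgeFrom AL2 CL 120 RAYS_20 = true ∧ CL.length = 1223 := ⟨by decide +kernel, tlen⟩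
/-- (hge), rays 126–131 (with the specimen-distinct conjunct `CL.length = 1223`). -/
theorem check_hge_21 : checkHgeFrom AL2 CL 126 RAYS_21 = true ∧ CL.length = 1223 := ⟨by decide +kernel, tlen⟩
/-- (hge), rays 132–137 (with the specimen-distinct conjunct `CL.length = 1223`). -/
theorem check_hge_22 : checkHgeFrom AL2 CL 132 RAYS_22 = true ∧ CL.length = 1223 := ⟨by decide +kernel, tlen⟩
/-- (hge), rays 138–138 (with the specimen-distinct conjunct `CL.length = 1223`). -/
theorem check_hge_23 : checkHgeFrom AL2 CL 138 RAYS_23 = true ∧ CL.length = 1223 := ⟨by decide +kernel, tlen⟩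

/-- ★ (hge) the vertex property on all 139 rays, glued from the 24 chunks (with the specimen-distinct conjunct `CL.length = 1223`). -/
theorem check_hge : checkHge AL2 RAYS CL = true ∧ CL.length = 1223 := by
  refine ⟨?_, tlen⟩
  obtain ⟨h0, h1, h2, h3, h4, h5, h6, h7, h8, h9, h10, h11, h12, h13, h14, h15, h16, h17, h18, h19, h20, h21, h22, h23⟩ := rlens
  rw [checkHge, RAYS]
  refine FanCheckChunks.checkHgeFrom_append_true (FanCheckChunks.checkHgeFrom_append_true (FanCheckChunks.checkHgeFrom_append_true (FanCheckChunks.checkHgeFrom_append_true (FanCheckChunks.checkHgeFrom_append_true (FanCheckChunks.checkHgeFrom_append_true (FanCheckChunks.checkHgeFrom_append_true (FanCheckChunks.checkHgeFrom_append_true (FanCheckChunks.checkHgeFrom_append_true (FanCheckChunks.checkHgeFrom_append_true (FanCheckChunks.checkHgeFrom_append_true (FanCheckChunks.checkHgeFrom_append_true (FanCheckChunks.checkHgeFrom_append_true (FanCheckChunks.checkHgeFrom_append_true (FanCheckChunks.checkHgeFrom_append_true (FanCheckChunks.checkHgeFrom_append_true (FanCheckChunks.checkHgeFrom_append_true (FanCheckChunks.checkHgeFrom_append_true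 (FanCheckChunks.checkHgeFrom_append_true (FanCheckChunks.checkHgeFrom_append_true (FanCheckChunks.checkHgeFrom_append_true (FanCheckChunks.checkHgeFrom_append_true (FanCheckChunks.checkHgeFrom_append_true check_hge_0.1 ?_) ?_) ?_) ?_) ?_) ?_) ?_) ?_) ?_) ?_) ?_) ?_) ?_) ?_) ?_) ?_) ?_) ?_) ?_) ?_) ?_) ?_) ?_
  · rw [h0]; exact check_hge_1.1
  · rw [List.length_append, h0, h1]; exact check_hge_2.1
  · rw [List.length_append, List.length_append, h0, h1, h2]; exact check_hge_3.1
  · rw [List.length_append, List.length_append, List.length_append, h0, h1, h2, h3]; exact check_hge_4.1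
  · rw [List.length_append, List.length_append, List.length_append, List.length_append, h0, h1, h2, h3, h4]; exact check_hge_5.1
  · rw [List.length_append, List.length_append, List.length_append, List.length_append, List.length_append, h0, h1, h2, h3, h4, h5]; exact check_hge_6.1
  · rw [List.length_append, List.length_append, List.length_append, List.length_append, List.length_append, List.length_append, h0, h1, h2, h3, h4, h5, h6]; exact check_hge_7.1
  · rw [List.length_append, List.length_append, List.length_append, List.length_append, List.length_append, List.length_append, List.length_append, h0, h1, h2, h3, h4, h5, h6, h7]; exact check_hge_8.1
  · rw [List.length_append, List.length_append, List.length_append, List.length_append, List.length_append, List.length_append, List.length_append, List.length_append, h0, h1, h2, h3, h4, h5, h6, h7, h8]; exact check_hge_9.1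
  · rw [List.length_append, List.length_append, List.length_append, List.length_append, List.length_append, List.length_append, List.length_append, List.length_append, List.length_append, h0, h1, h2, h3, h4, h5, h6, h7, h8, h9]; exact check_hge_10.1
  · rw [List.length_append, List.length_append, List.length_append, List.length_append, List.length_append, List.length_append, List.length_append, List.length_append, List.length_append, List.length_append, h0, h1, h2, h3, h4, h5, h6, h7, h8, h9, h10]; exact check_hge_11.1
  · rw [List.length_append, List.length_append, List.length_append, List.length_append, List.length_append, List.length_append, List.length_append, List.length_append, List.length_append, List.length_append, List.length_append, h0, h1, h2, h3, h4, h5, h6, h7, h8, h9, h10, h11]; exact check_hge_12.1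
  · rw [List.length_append, List.length_append, List.length_append, List.length_append, List.length_append, List.length_append, List.length_append, List.length_append, List.length_append, List.length_append, List.length_append, List.length_append, h0, h1, h2, h3, h4, h5, h6, h7, h8, h9, h10, h11, h12]; exact check_hge_13.1
  · rw [List.length_append, List.length_append, List.length_append, List.length_append, List.length_append, List.length_append, List.length_append, List.length_append, List.length_append, List.length_append, List.length_append, List.length_append, List.length_append, h0, h1, h2, h3, h4, h5, h6, h7, h8, h9, h10, h11, h12, h13]; exact check_hge_14.1
  · rw [List.length_append, List.length_append, List.length_append, List.length_append, List.length_append, List.length_append, List.length_append, List.length_append, List.length_append, List.length_append, List.length_append, List.length_append, List.length_append, List.length_append, h0, h1, h2, h3, h4, h5, h6, h7, h8, h9, h10, h11, h12, h13, h14]; exact check_hge_15.1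
  · rw [List.length_append, List.length_append, List.length_append, List.length_append, List.length_append, List.length_append, List.length_append, List.length_append, List.length_append, List.length_append, List.length_append, List.length_append, List.length_append, List.length_append, List.length_append, h0, h1, h2, h3, h4, h5, h6, h7, h8, h9, h10, h11, h12, h13, h14, h15]; exact check_hge_16.1
  · rw [List.length_append, List.length_append, List.length_append, List.length_append, List.length_append, List.length_append, List.length_append, List.length_append, List.length_append, List.length_append, List.length_append, List.length_append, List.length_append, List.length_append, List.length_append, List.length_append, h0, h1, h2, h3, h4, h5, h6, h7, h8, h9, h10, h11, h12, h13, h14, h15, h16]; exact check_hge_17.1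
  · rw [List.length_append, List.length_append, List.length_append, List.length_append, List.length_append, List.length_append, List.length_append, List.length_append, List.length_append, List.length_append, List.length_append, List.length_append, List.length_append, List.length_append, List.length_append, List.length_append, List.length_append, h0, h1, h2, h3, h4, h5, h6, h7, h8, h9, h10, h11, h12, h13, h14, h15, h16, h17]; exact check_hge_18.1
  · rw [List.length_append, List.length_append, List.length_append, List.length_append, List.length_append, List.length_append, List.length_append, List.length_append, List.length_append, List.length_append, List.length_append, List.length_append, List.length_append, List.length_append, List.length_append, List.length_append, List.length_append, List.length_append, h0, h1, h2, h3, h4, h5, h6, h7, h8, h9, h10, h11, h12, h13, h14, h15, h16, h17, h18]; exact check_hge_19.1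
  · rw [List.length_append, List.length_append, List.length_append, List.length_append, List.length_append, List.length_append, List.length_append, List.length_append, List.length_append, List.length_append, List.length_append, List.length_append, List.length_append, List.length_append, List.length_append, List.length_append, List.length_append, List.length_append, List.length_append, h0, h1, h2, h3, h4, h5, h6, h7, h8, h9, h10, h11, h12, h13, h14, h15, h16, h17, h18, h19]; exact check_hge_20.1
  · rw [List.length_append, List.length_append, List.length_append, List.length_append, List.length_append, List.length_append, List.length_append, List.length_append, List.length_append, List.length_append, List.length_append, List.length_append, List.length_append, List.length_append, List.length_append, List.length_append, List.length_append, List.length_append, List.length_append, List.length_append, h0, h1, h2, h3, h4, h5, h6, h7, h8, h9, h10, h11, h12, h13, h14, h15, h16, h17, h18, h19, h20]; exact check_hge_21.1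
  · rw [List.length_append, List.length_append, List.length_append, List.length_append, List.length_append, List.length_append, List.length_append, List.length_append, List.length_append, List.length_append, List.length_append, List.length_append, List.length_append, List.length_append, List.length_append, List.length_append, List.length_append, List.length_append, List.length_append, List.length_append, List.length_append, h0, h1, h2, h3, h4, h5, h6, h7, h8, h9, h10, h11, h12, h13, h14, h15, h16, h17, h18, h19, h20, h21]; exact check_hge_22.1
  · rw [List.length_append, List.length_append, List.length_append, List.length_append, List.length_append, List.length_append, List.length_append, List.length_append, List.length_append, List.length_append, List.length_append, List.length_append, List.length_append, List.length_append, List.length_append, List.length_append, List.length_append, List.length_append, List.length_append, List.length_append, List.length_append, List.length_append, h0, h1, h2, h3, h4, h5, h6, h7, h8, h9, h10, h11, h12, h13, h14, h15, h16, h17, h18, h19, h20, h21, h22]; exact check_hge_23.1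


end Summit.ResolutionOfSingularities.ResolutionOfSingularities.Theorems.FInjectiveMacaulayfication.OmegaOneS2KNewtonKFan
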